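import Summits.QuantumFields.YangMills.Theorems.IR.ShellMaxCorrEngine
import Summits.QuantumFields.YangMills.Theorems.IR.ShellMaxCorrCollarBridge

/-!
# Crux `IR` (item stmt-QuantumFields-19354; re-typed leaf `IRcof`, item stmt-QuantumFields-26930) — merged line
«maximal correlation at one physical thickness»: the engines ON A SET OF COUPLINGS and the compositions to `IRcof`

Helper module for item `stmt-QuantumFields-19354` (`--supports … --as helper`; it closes nothing; lead prover
ym-ir-line-mxc-p1 g5).  The infrared leaf of `route-QuantumFields-BalabanLadder` was RE-TYPED (21-frontier approval of
R423, executed R424, route rev 12) to its COFINAL form `Summit.QuantumFields.YangMills.Theses.BalabanLadder.IRcof`: the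
`GapInUnits` family of volume-uniform clustering bounds is owed only for the couplings of SOME SET `Bset ⊆ ℝ` UNBOUNDED ABOVE,
not for all large `β`.  Director-ym №25 (2) asks every line to RE-PRICE itself against the re-typed leaf.  This file is the
kernel-checked part of the re-pricing of the merged maximal-correlation line (shell certificate `ShellMaxCorr.*`, collar
surrogates `CollarDecoupling.*`, vocabulary `Theorems/IR/ShellMaxCorrDefs.lean`):

* §1 `abs_latticeConnectedCorr_le_exp_of_shellCert` — the engine's PER-COUPLING KERNEL: at ONE coupling `β` with unit
  `ab = a(β) ≤ K₀`, a shell certificate `Ψ_β(⌈K₀/ab⌉) ≤ θ₁ < 1` on the torus of side `2S+1` (every inner radius) bounds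
  `|⟨A τ_n B⟩ − ⟨A⟩⟨B⟩| ≤ 2 C_A C_B e^{c₁ K₀ (r_A+r_B+2)} · e^{−c₁ ab n}` for every `n ≤ S`, `c₁ = |log θ₁|/(6K₀)` — the
  constants see `β` only through `ab`.  (The landed `stub_shellEngine`, `Theorems/IR/ShellMaxCorrEngine.lean`, is this
  kernel at every `β ≥ β₂`; its proof is by-cases on the separation and is reproduced here once, per coupling.)
* §2 `gapOn_of_shellCertOn` — THE ENGINE ON A COUPLING SET: a shell certificate at one physical thickness for the couplings
  `β ∈ Bset`, `β ≥ β₂`, and all large tori gives the `GapInUnits` family ON `Bset` (the body of `IRcof`'s conclusion, written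
  out as in `Theorems/BalabanLadderIRCofinalCouplingsBridge.lean` — no new definition).  `Bset = univ` is `ShellEngine`.
* §3 `shellCertOn_of_collarOnsetOn` — the collar currency ON `Bset` implies the shell certificate ON `Bset` (the landed
  per-coupling bridge `shellCert_of_collarDecouplingAt`, `Theorems/IR/ShellMaxCorrCollarBridge.lean`).
* §4 the compositions concluding the re-typed route decl BY NAME: `ircof_of_shellCertCof` (hypothesis = the COFINAL shell
  load: `LowerBounds ⇒ ∃ Bset` unbounded above with the certificate on `Bset`), `ircof_of_collarOnsetCof` (hypothesis = the
  COFINAL collar load), and `shellCertCof_of_irShellCorr` (the load of record `IRShellCorr` implies the cofinal load, with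
  `Bset = univ`).  The cofinal loads are the ONLY `sorry`s of the cofinal skeleton `Cruxes/IR/Lines/shell_maxcorr_doubling_cofinal.lean`.

RE-PRICING VERDICT (the prose goes on the bus): WALL UNCHANGED.  The load of the line was never the quantifier «for all large
β» but the certificate AT a large coupling, uniformly in the inner radius and the volume; the engine is per-coupling, so the
line closes `IRcof` modulo the cofinal load and nothing else; class of the load (EQUIV-or-stronger than the leaf at each
certified coupling; simplicity of `G` load-bearing) unchanged.  HONEST FRAMING: bookkeeping + an abstract per-coupling kernel;
no weak-coupling decorrelation, no lattice mass gap and no part of the Clay Yang–Mills problem is proved here; the lines are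
CONDITIONAL rung lines; R4 closes only the finite-𝕋⁴ UV rung `BalabanLadder.UV`.

Refs: Bradley, *Basic properties of strong mixing conditions*, Probab. Surveys 2 (2005) §1; the tree files above.
-/

set_option autoImplicit false

noncomputable section

open Filter Topology MeasureTheory ProbabilityTheory
open Literature.MathematicalPhysics.QuantumFieldTheory Literature.MathematicalPhysics.QuantumLattice
open Literature.Probability.LatticeModels (Torus.proj)
open Summit.QuantumFields.YangMills.Cruxes.OSLegsFromFemtoAndGap.DlrCollarTransfer (GapInUnits LowerBounds)

namespace Summit.QuantumFields.YangMills.Cruxes.IR.ShellMaxCorr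

/-! ## §1 The per-coupling kernel of the engine -/

section Kernel

variable {G : Type} [Group G] [TopologicalSpace G] [IsTopologicalGroup G] [CompactSpace G]
  [MeasurableSpace G] [BorelSpace G]

/-- **Per-coupling kernel of the shell engine.**  At one coupling `β` with unit `0 < ab ≤ K₀` and certified constant
`0 < θ₁ < 1`: if `Ψ_β(⌈K₀/ab⌉) ≤ θ₁` on the torus of side `2S+1` (every inner radius), then for local observables `A`, `B`
with inner/outer support radii `r_A`, `r_B` (`exists_radius_dependsOn_inBall/outBall`) and sup bounds `C_A`, `C_B`, and every
time separation `n ≤ S`,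
`|⟨A τ_n B⟩ − ⟨A⟩⟨B⟩| ≤ 2 C_A C_B · exp(c₁ K₀ (r_A + r_B + 2)) · exp(−c₁ · ab · n)`, `c₁ = −log θ₁ / (6 K₀)`.
Large separations: doubling-law decay (`abs_latticeConnectedCorr_le_of_shellCert`) and `rate_bound_large`; small
separations: the trivial bound and `rate_bound_small`. -/
theorem abs_latticeConnectedCorr_le_exp_of_shellCert [T2Space G] [SecondCountableTopology G] {m : ℕ}
    (ρ : G →* Matrix (Fin m) (Fin m) ℂ) (hρ : Continuous ρ) {K₀ θ₁ ab : ℝ} (hK₀ : 0 < K₀)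
    (hθ0 : 0 < θ₁) (hθ1 : θ₁ < 1) (hab : 0 < ab) (habK : ab ≤ K₀) (β : ℝ) (S : ℕ)
    (hcert : ShellCert ρ β S ⌈K₀ / ab⌉₊ θ₁)
    (A B : LocalGaugeObservable 4 G) {rA rB : ℕ} {CA CB : ℝ}
    (hA : ∀ (N : ℕ) [NeZero N], DependsOn (fun U : GaugeConfig 4 N G => A.F (torusLift N U)) {e | InBall rA e})
    (hB : ∀ (S n : ℕ), n ≤ S → DependsOn (fun U : GaugeConfig 4 (2 * S + 1) G =>
        B.F (configShift (-Pi.single 0 (n : ℤ)) (torusLift (2 * S + 1) U))) {e | OutBall (n - rB) e})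
    (hCA : ∀ U, |A.F U| ≤ CA) (hCB : ∀ U, |B.F U| ≤ CB) {n : ℕ} (hnS : n ≤ S) :
    |latticeConnectedCorr ρ β (2 * S + 1) A.F B.F n| ≤
      2 * CA * CB * Real.exp (-Real.log θ₁ / (6 * K₀) * K₀ * ((rA : ℝ) + rB + 2)) *
        Real.exp (-(-Real.log θ₁ / (6 * K₀) * ab * n)) := by
  have hlogneg : Real.log θ₁ < 0 := Real.log_neg hθ0 hθ1
  have hlam : 0 < -Real.log θ₁ := neg_pos.2 hlogneg
  have hCA0 : 0 ≤ CA := (abs_nonneg _).trans (hCA (fun _ => 1))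
  have hCB0 : 0 ≤ CB := (abs_nonneg _).trans (hCB (fun _ => 1))
  have hs₀lt : ((⌈K₀ / ab⌉₊ : ℕ) : ℝ) < K₀ / ab + 1 := Nat.ceil_lt_add_one (by positivity)
  haveI : IsProbabilityMeasure (wilsonMeasure (d := 4) (L := 2 * S + 1) ρ β) :=
    isProbabilityMeasure_wilsonMeasure (d := 4) (L := 2 * S + 1) ρ hρ β
  -- join the two exponentials
  have hsplit : 2 * CA * CB * Real.exp (-Real.log θ₁ / (6 * K₀) * K₀ * ((rA : ℝ) + rB + 2)) *
        Real.exp (-(-Real.log θ₁ / (6 * K₀) * ab * n)) =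
      2 * CA * CB * Real.exp (-Real.log θ₁ / (6 * K₀) * K₀ * ((rA : ℝ) + rB + 2) -
        -Real.log θ₁ / (6 * K₀) * ab * n) := by
    rw [sub_eq_add_neg, Real.exp_add]; ring
  rw [hsplit]
  by_cases hcase : rA + rB + ⌈K₀ / ab⌉₊ ≤ n
  · -- large separations: the certificate
    have h := abs_latticeConnectedCorr_le_of_shellCert ρ hρ β S ⌈K₀ / ab⌉₊ hθ0 hθ1.le hcert
      A B hA hB hCA hCB hnS hcase
    refine h.trans ?_
    have hrate := rate_bound_large (lam := -Real.log θ₁) (s₀ := ⌈K₀ / ab⌉₊) (n := n) (rA := rA) (rB := rB)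
      hlam hK₀ hab habK hs₀lt hcase
    have hexp : Real.exp (Real.log θ₁ * (((n : ℝ) + 1 - rA - rB) / (2 * (((⌈K₀ / ab⌉₊ : ℕ) : ℝ) + 1)))) ≤
        Real.exp (-Real.log θ₁ / (6 * K₀) * K₀ * ((rA : ℝ) + rB + 2) - -Real.log θ₁ / (6 * K₀) * ab * n) := by
      refine Real.exp_le_exp.2 ?_
      have e : Real.log θ₁ * (((n : ℝ) + 1 - rA - rB) / (2 * (((⌈K₀ / ab⌉₊ : ℕ) : ℝ) + 1))) =
          -(-Real.log θ₁) * (((n : ℝ) + 1 - rA - rB) / (2 * (((⌈K₀ / ab⌉₊ : ℕ) : ℝ) + 1))) := by ring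
      rw [e]; exact hrate
    calc CA * CB * Real.exp (Real.log θ₁ * (((n : ℝ) + 1 - rA - rB) / (2 * (((⌈K₀ / ab⌉₊ : ℕ) : ℝ) + 1))))
        ≤ CA * CB * Real.exp (-Real.log θ₁ / (6 * K₀) * K₀ * ((rA : ℝ) + rB + 2) -
            -Real.log θ₁ / (6 * K₀) * ab * n) :=
          mul_le_mul_of_nonneg_left hexp (mul_nonneg hCA0 hCB0)
      _ ≤ 2 * CA * CB * Real.exp (-Real.log θ₁ / (6 * K₀) * K₀ * ((rA : ℝ) + rB + 2) -
            -Real.log θ₁ / (6 * K₀) * ab * n) := by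
          have : 0 ≤ CA * CB * Real.exp (-Real.log θ₁ / (6 * K₀) * K₀ * ((rA : ℝ) + rB + 2) -
              -Real.log θ₁ / (6 * K₀) * ab * n) :=
            mul_nonneg (mul_nonneg hCA0 hCB0) (Real.exp_nonneg _)
          linarith
  · -- small separations: the trivial bound
    rw [not_le] at hcase
    have hrate := rate_bound_small (lam := -Real.log θ₁) (s₀ := ⌈K₀ / ab⌉₊) (n := n) (rA := rA) (rB := rB)
      hlam hK₀ hab habK hs₀lt hcase
    have htriv : |latticeConnectedCorr ρ β (2 * S + 1) A.F B.F n| ≤ 2 * CA * CB := by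
      unfold latticeConnectedCorr
      rw [← integral_comp_configShift_torusLift ρ β B.F (-Pi.single 0 (n : ℤ))]
      exact abs_corr_le_two_mul _ (fun U => hCA _) (fun U => hCB _) hCA0
    refine htriv.trans ?_
    have h1 : 1 ≤ Real.exp (-Real.log θ₁ / (6 * K₀) * K₀ * ((rA : ℝ) + rB + 2) -
        -Real.log θ₁ / (6 * K₀) * ab * n) :=
      Real.one_le_exp hrate
    have h0 : 0 ≤ 2 * CA * CB := by positivity
    nlinarith

end Kernel

/-! ## §2 The engine on a set of couplings -/

section OnCouplings

variable {G : Type} [Group G] [TopologicalSpace G] [IsTopologicalGroup G] [CompactSpace G]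
  [MeasurableSpace G] [BorelSpace G]

/-- **THE ENGINE ON A COUPLING SET.**  For a lattice representation `r` (so `G` is compact metrisable), a positive unit map
`a → 0` and ANY set of couplings `Bset`: a shell maximal-correlation certificate at ONE physical thickness `K₀` with
constant `θ < 1` (no sign condition is needed: the certificate is monotone in `θ`, and `max θ ½` is used) for the
couplings `β ∈ Bset`, `β ≥ β₂`, on all tori `S ≥ S₁ β` and every inner radius, gives the
`GapInUnits` family of clustering bounds ON `Bset` (one rate `c₁ = |log max(θ,½)|/(6K₀)`, one constant per pair of species,
thresholds `max β₂ β₃` with `a ≤ K₀` beyond `β₃`, and the certificate's own `S₁`) — the conclusion of the re-typed leaf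
`BalabanLadder.IRcof` for `(G, r, a, Bset)`, written out.  `Bset = univ` is the landed `stub_shellEngine`. -/
theorem gapOn_of_shellCertOn (r : LatticeRep G) (a : ℝ → ℝ) (ha : ∀ β, 0 < a β)
    (ha0 : Tendsto a atTop (𝓝 0)) (Bset : Set ℝ) {K₀ θ β₂ : ℝ} {S₁ : ℝ → ℕ}
    (hK₀ : 0 < K₀) (hθ1 : θ < 1)
    (hc : ∀ β ∈ Bset, β₂ ≤ β → ∀ S : ℕ, S₁ β ≤ S → ShellCert r.ρ β S ⌈K₀ / a β⌉₊ θ) :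
    ∃ (c₁ β₂' : ℝ) (S₁' : ℝ → ℕ), 0 < c₁ ∧ ∀ A B : YMSpecies G, ∃ C : ℝ, ∀ β ∈ Bset, β₂' ≤ β →
      ∀ S n : ℕ, S₁' β ≤ S → n ≤ S →
        |latticeConnectedCorr r.ρ β (2 * S + 1) A.F B.F n| ≤ C * Real.exp (-(c₁ * a β * n)) := by
  haveI : SecondCountableTopology G :=
    (r.continuous.isClosedEmbedding r.injective).isEmbedding.secondCountableTopology
  haveI : T2Space G := (r.continuous.isClosedEmbedding r.injective).isEmbedding.t2Space
  -- a certificate constant in `[1/2, 1)`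
  have hθ₁pos : 0 < max θ (1 / 2) := lt_of_lt_of_le one_half_pos (le_max_right _ _)
  have hθ₁lt : max θ (1 / 2) < 1 := max_lt hθ1 one_half_lt_one
  have hθθ₁ : θ ≤ max θ (1 / 2) := le_max_left _ _
  have hlam : 0 < -Real.log (max θ (1 / 2)) := neg_pos.2 (Real.log_neg hθ₁pos hθ₁lt)
  -- eventually `a β ≤ K₀`
  obtain ⟨β₃, hβ₃⟩ : ∃ β₃ : ℝ, ∀ β, β₃ ≤ β → a β ≤ K₀ :=
    eventually_atTop.1 (ha0.eventually (eventually_le_nhds hK₀))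
  refine ⟨-Real.log (max θ (1 / 2)) / (6 * K₀), max β₂ β₃, S₁, div_pos hlam (by positivity), fun A B => ?_⟩
  obtain ⟨rA, hA⟩ := exists_radius_dependsOn_inBall A
  obtain ⟨rB, hB⟩ := exists_radius_dependsOn_outBall B
  obtain ⟨CA, hCA⟩ := A.bounded
  obtain ⟨CB, hCB⟩ := B.bounded
  refine ⟨2 * CA * CB * Real.exp (-Real.log (max θ (1 / 2)) / (6 * K₀) * K₀ * ((rA : ℝ) + rB + 2)),
    fun β hβB hβ S n hS hn => ?_⟩
  have hβ₂ : β₂ ≤ β := (le_max_left _ _).trans hβ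
  have habK : a β ≤ K₀ := hβ₃ β ((le_max_right _ _).trans hβ)
  have hcert' : ShellCert r.ρ β S ⌈K₀ / a β⌉₊ (max θ (1 / 2)) :=
    shellCert_mono le_rfl hθθ₁ (hc β hβB hβ₂ S hS)
  exact abs_latticeConnectedCorr_le_exp_of_shellCert r.ρ r.continuous hK₀ hθ₁pos hθ₁lt (ha β) habK β S hcert'
    A B hA hB hCA hCB hn

/-! ## §3 The collar currency on a set of couplings gives the shell certificate there -/

/-- **Collar onset ON `Bset` ⇒ shell certificate ON `Bset`** (thickness `K₀ = max T 1 + 2`, constant `θ = 1/2`, no volume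
threshold): the per-coupling bridge `shellCert_of_collarDecouplingAt` (`CollarDecouplingAt ρ β b → ShellCert ρ β S (b+2) ½`)
and monotonicity in the thickness, using `a β ≤ 1` eventually.  `Bset = univ` is the landed
`shellCertificate_of_collarOnset`. -/
theorem shellCertOn_of_collarOnsetOn (r : LatticeRep G) (a : ℝ → ℝ) (ha : ∀ β, 0 < a β)
    (ha0 : Tendsto a atTop (𝓝 0)) (Bset : Set ℝ)
    (h : ∃ T β₂ : ℝ, ∀ β ∈ Bset, β₂ ≤ β →
      ∃ b : ℕ, 1 ≤ b ∧ a β * (b : ℝ) < T ∧ CollarDecoupling.CollarDecouplingAt r.ρ β b) :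
    ∃ (K₀ θ β₂ : ℝ) (S₁ : ℝ → ℕ), 0 < K₀ ∧ 0 ≤ θ ∧ θ < 1 ∧
      ∀ β ∈ Bset, β₂ ≤ β → ∀ S : ℕ, S₁ β ≤ S → ShellCert r.ρ β S ⌈K₀ / a β⌉₊ θ := by
  obtain ⟨T, β₂, hb⟩ := h
  -- eventually `a β ≤ 1`
  obtain ⟨β₃, hβ₃⟩ : ∃ β₃ : ℝ, ∀ β, β₃ ≤ β → a β ≤ 1 :=
    eventually_atTop.1 (ha0.eventually (eventually_le_nhds one_pos))
  refine ⟨max T 1 + 2, 1 / 2, max β₂ β₃, fun _ => 0, by positivity, by norm_num, by norm_num,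
    fun β hβB hβ S _ => ?_⟩
  obtain ⟨b, hb1, hbT, hP⟩ := hb β hβB ((le_max_left _ _).trans hβ)
  have hab : 0 < a β := ha β
  have hcert := shellCert_of_collarDecouplingAt r.ρ r.continuous β hP S
  refine shellCert_mono ?_ le_rfl hcert
  -- `b + 2 ≤ ⌈(max T 1 + 2) / a β⌉₊`
  have ha1 : a β ≤ 1 := hβ₃ β ((le_max_right _ _).trans hβ)
  have hreal : ((b : ℝ) + 2) ≤ (max T 1 + 2) / a β := by
    rw [le_div_iff₀ hab]
    have h1 : (b : ℝ) * a β < T := by rw [mul_comm]; exact hbT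
    have h2 : T ≤ max T 1 := le_max_left _ _
    have hb0 : (0 : ℝ) ≤ b := Nat.cast_nonneg _
    nlinarith
  have hceil : ((b : ℝ) + 2) ≤ (⌈(max T 1 + 2) / a β⌉₊ : ℝ) := hreal.trans (Nat.le_ceil _)
  exact_mod_cast hceil

end OnCouplings

/-! ## §4 Compositions concluding the re-typed route decl `BalabanLadder.IRcof` BY NAME -/

/-- **COFINAL SHELL LOAD ⇒ `IRcof`.**  The hypothesis is the cofinal re-cut of the line's load `IRShellCorr`: for compact
SIMPLE `G`, non-triviality in units `a` (`LowerBounds`) gives a set of couplings `Bset` UNBOUNDED ABOVE on which the shell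
maximal-correlation certificate at one physical thickness holds (all large tori, every inner radius).  With the engine on
`Bset` (§2) this is the re-typed leaf, literally. -/
theorem ircof_of_shellCertCof
    (h : ∀ (G : Type) [Group G] [TopologicalSpace G] [IsTopologicalGroup G] [CompactSpace G],
      IsCompactSimpleLieGroup G → letI : MeasurableSpace G := borel G; haveI : BorelSpace G := ⟨rfl⟩;
      ∀ (r : LatticeRep G) (a : ℝ → ℝ), (∀ β, 0 < a β) → Tendsto a atTop (𝓝 0) → LowerBounds G r a →
        ∃ Bset : Set ℝ, (∀ x : ℝ, ∃ β ∈ Bset, x ≤ β) ∧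
          ∃ (K₀ θ β₂ : ℝ) (S₁ : ℝ → ℕ), 0 < K₀ ∧ 0 ≤ θ ∧ θ < 1 ∧
            ∀ β ∈ Bset, β₂ ≤ β → ∀ S : ℕ, S₁ β ≤ S → ShellCert r.ρ β S ⌈K₀ / a β⌉₊ θ) :
    Summit.QuantumFields.YangMills.Theses.BalabanLadder.IRcof := by
  delta Summit.QuantumFields.YangMills.Theses.BalabanLadder.IRcof
  intro G _ _ _ _ hG
  letI : MeasurableSpace G := borel G
  haveI : BorelSpace G := ⟨rfl⟩
  intro r a ha ha0 hlb
  obtain ⟨Bset, hcof, K₀, θ, β₂, S₁, hK₀, -, hθ1, hc⟩ := h G hG r a ha ha0 hlb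
  exact ⟨Bset, hcof, gapOn_of_shellCertOn r a ha ha0 Bset hK₀ hθ1 hc⟩

/-- **COFINAL COLLAR LOAD ⇒ `IRcof`.**  The hypothesis is the cofinal re-cut of the collar typing's load
`CollarDecoupling.CollarSharpOnset`: for compact SIMPLE `G`, `LowerBounds` gives a set of couplings UNBOUNDED ABOVE on which
the collar format holds at some mesh `b ≥ 1` of bounded physical width `a β · b < T`.  Route: §3 then §2. -/
theorem ircof_of_collarOnsetCof
    (h : ∀ (G : Type) [Group G] [TopologicalSpace G] [IsTopologicalGroup G] [CompactSpace G],
      IsCompactSimpleLieGroup G → letI : MeasurableSpace G := borel G; haveI : BorelSpace G := ⟨rfl⟩;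
      ∀ (r : LatticeRep G) (a : ℝ → ℝ), (∀ β, 0 < a β) → Tendsto a atTop (𝓝 0) → LowerBounds G r a →
        ∃ Bset : Set ℝ, (∀ x : ℝ, ∃ β ∈ Bset, x ≤ β) ∧
          ∃ T β₂ : ℝ, ∀ β ∈ Bset, β₂ ≤ β → ∃ b : ℕ, 1 ≤ b ∧ a β * (b : ℝ) < T ∧
            CollarDecoupling.CollarDecouplingAt r.ρ β b) :
    Summit.QuantumFields.YangMills.Theses.BalabanLadder.IRcof := by
  delta Summit.QuantumFields.YangMills.Theses.BalabanLadder.IRcof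
  intro G _ _ _ _ hG
  letI : MeasurableSpace G := borel G
  haveI : BorelSpace G := ⟨rfl⟩
  intro r a ha ha0 hlb
  obtain ⟨Bset, hcof, hT⟩ := h G hG r a ha ha0 hlb
  obtain ⟨K₀, θ, β₂, S₁, hK₀, -, hθ1, hc⟩ := shellCertOn_of_collarOnsetOn r a ha ha0 Bset hT
  exact ⟨Bset, hcof, gapOn_of_shellCertOn r a ha ha0 Bset hK₀ hθ1 hc⟩

/-- **The load of record implies the cofinal load** (`Bset = univ`): the cofinal re-cut is WEAKER than `IRShellCorr`
(and does not use `LowerBounds` beyond passing it on). -/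
theorem shellCertCof_of_irShellCorr (hC : IRShellCorr) :
    ∀ (G : Type) [Group G] [TopologicalSpace G] [IsTopologicalGroup G] [CompactSpace G],
      IsCompactSimpleLieGroup G → letI : MeasurableSpace G := borel G; haveI : BorelSpace G := ⟨rfl⟩;
      ∀ (r : LatticeRep G) (a : ℝ → ℝ), (∀ β, 0 < a β) → Tendsto a atTop (𝓝 0) → LowerBounds G r a →
        ∃ Bset : Set ℝ, (∀ x : ℝ, ∃ β ∈ Bset, x ≤ β) ∧
          ∃ (K₀ θ β₂ : ℝ) (S₁ : ℝ → ℕ), 0 < K₀ ∧ 0 ≤ θ ∧ θ < 1 ∧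
            ∀ β ∈ Bset, β₂ ≤ β → ∀ S : ℕ, S₁ β ≤ S → ShellCert r.ρ β S ⌈K₀ / a β⌉₊ θ := by
  intro G _ _ _ _ hG
  letI : MeasurableSpace G := borel G
  haveI : BorelSpace G := ⟨rfl⟩
  intro r a ha ha0 hlb
  obtain ⟨K₀, θ, β₂, S₁, hK₀, hθ0, hθ1, hc⟩ := hC G hG r a ha ha0 hlb
  exact ⟨Set.univ, fun x => ⟨x, Set.mem_univ _, le_rfl⟩, K₀, θ, β₂, S₁, hK₀, hθ0, hθ1,
    fun β _ hβ S hS => hc β hβ S hS⟩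

/-- **`IR ⇒ IRcof` through this line's currency is consistent with the tree:** the load of record closes the re-typed leaf
(composition of `shellCertCof_of_irShellCorr` and `ircof_of_shellCertCof`; cf. the spine's `IRcof_of_IR`). -/
theorem ircof_of_irShellCorr (hC : IRShellCorr) : Summit.QuantumFields.YangMills.Theses.BalabanLadder.IRcof :=
  ircof_of_shellCertCof (shellCertCof_of_irShellCorr hC)

end Summit.QuantumFields.YangMills.Cruxes.IR.ShellMaxCorr

end
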